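import Summits.CriticalPhenomena.SAWScalingLimit.Theorems.ObservableToSLE.Negative.Identification
import Summits.CriticalPhenomena.SAWScalingLimit.Theorems.ObservableToSLE.Negative.ChordalCarrier
import Summits.CriticalPhenomena.SAWScalingLimit.Theorems.SAWDevelopingMapObservableToSLEChordalCarrierLimits
import Summits.CriticalPhenomena.SAWScalingLimit.Theorems.SAWDevelopingMapHexConjectureRangeIdentificationHyperspace
import HarnessLib

/-!
# Crux `ObservableToSLE` / `ObservableToSLER` (stmt-CriticalPhenomena-10472 ≡ stmt-14005), line
`hull-first-retrace`, stub C `stub_curveLawOfRangeLaw`: the curve law from the trace law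

Landing target:
`Summits/CriticalPhenomena/SAWScalingLimit/Theorems/SAWDevelopingMapObservableToSLEHullFirstCurveLawOfRangeLaw.lean`
(`--supports stmt-CriticalPhenomena-10472`; the stub is registered with the same text on
stmt-CriticalPhenomena-14005, skeleton `Cruxes/ObservableToSLER/Lines/hull_first_retrace.lean`).

**Statement** (`stub_curveLawOfRangeLaw`, byte-identical with the skeleton):
`HexRangeLimit → HexNoRetraceLimits → MonotoneOfNoRetrace → CurveIdentification` — if (1) the law
of the TRACE of the critical hexagonal SAW converges (Hausdorff metric on `NonemptyCompacts ℂ`) to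
the law of the trace of a chordal SLE(8/3) random curve `Γ`, (2) subsequential weak limits of the
CURVE laws give no mass to classes with a retracing representative, and (3) a class whose range is
the range of an injective curve from the class's source and none of whose representatives
retraces is the class of that curve, then every probability subsequential limit `μ` of the curve
laws is an SLE(8/3) law.

**Proof.**  Let `P` be the pre-Wiener measure, `ν := P.map Γ`, `F : CurveClass ℂ → NonemptyCompacts ℂ`
the trace map `c ↦ ⟨range c, _, _⟩` (continuous, `1`-Lipschitz: `continuous_rangeNC` of
`…HexConjectureRangeIdentificationHyperspace`) and `S := simple ∩ {source = a}`.
* (i) `μ.map F = ν.map F`: both are the weak limit of the trace laws along the mesh sequence of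
  `μ` (test `g ∘ F` for `g` bounded continuous on the hyperspace; limits in `ℝ` are unique; finite
  Borel measures on a metric space are determined by such integrals).
* (ii) `ν`-a.e. class lies in `S` (`Negative.ae_mem_chordalCarrier_of_isSLELaw_eightThirds`);
  `μ`-a.e. class has source `a` (`FloorRatio.ae_source_eq`) and no retracing representative (2).
* (iii) `F` is injective on `S`, and more generally a class with source `a` and no retracing
  representative sharing its trace with a member of `S` IS that member: hypothesis (3), the other
  class being `mk α` with `α` injective, and a representative of a simple class being flat
  (`Negative.isFlat_of_mk_mem_simple`) hence never retracing.
* (iv) Lusin–Souslin (`ContinuousOn.measurableEmbedding`, `MeasurableSet.image_of_continuousOn_injOn`;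
  `CurveClass ℂ` is Polish): `F '' S` is Borel and `F|S` has a measurable left inverse `Ψ`.  By (i),
  (ii) `μ`-a.e. `F c ∈ F '' S`, so by (iii) `μ`-a.e. `c ∈ S`; hence `μ = (μ.map F).map Ψ =
  (ν.map F).map Ψ = ν` (`measure_eq_of_map_eq_of_injOn`).

References: Lusin–Souslin (Kechris, *Classical Descriptive Set Theory*, Thm. 15.1; Mathlib);
P. Billingsley, *Convergence of probability measures* (1999), Thm. 1.2 (a finite Borel measure on a
metric space is determined by the integrals of bounded continuous functions).
-/

noncomputable section

open scoped BigOperators Topology NNReal ENNReal Classical BoundedContinuousFunction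
open Filter Set MeasureTheory Metric
open Literature.Probability.LatticeModels (HexVertex hexGraph hexCenter)
open Literature.Probability.RandomPlanarGeometry
open Literature.Probability.RandomPlanarGeometry.SAW

namespace Summit.CriticalPhenomena.SAWScalingLimit.Theorems.ObservableToSLER.HullFirst

open TopologicalSpace (NonemptyCompacts)
open Summit.CriticalPhenomena.SAWScalingLimit.Theorems.ObservableToSLE
open Summit.CriticalPhenomena.SAWScalingLimit.Theorems.HexConjecture.RootLocality.Range
  (continuous_rangeNC)

/-! ### Identification of two measures from a common push-forward (Lusin–Souslin) -/

/-- **Two measures with the same push-forward under a map injective where they live coincide.**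
Let `F : X → Y` be continuous from a Polish space to a Hausdorff space (Borel σ-algebras), `S ⊆ X`
Borel with `F` injective on `S`.  If `μ.map F = ν.map F`, `ν` is carried by `S`, and `μ`-a.e. point
`x` equals every point of `S` with the same image, then `μ = ν`: by Lusin–Souslin `F '' S` is Borel
and `F|S` has a measurable left inverse `Ψ`, `μ` is carried by `F ⁻¹' (F '' S)` hence by `S`, and
both measures equal `(μ.map F).map Ψ`. [folklore] -/
theorem measure_eq_of_map_eq_of_injOn {X Y : Type*} [TopologicalSpace X] [PolishSpace X]
    [MeasurableSpace X] [BorelSpace X] [TopologicalSpace Y] [T2Space Y] [MeasurableSpace Y]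
    [BorelSpace Y] {F : X → Y} (hF : Continuous F) {S : Set X} (hS : MeasurableSet S)
    (hinj : InjOn F S) {μ ν : Measure X} (hmap : μ.map F = ν.map F) (hν : ∀ᵐ x ∂ν, x ∈ S)
    (hμ : ∀ᵐ x ∂μ, ∀ y ∈ S, F y = F x → x = y) : μ = ν := by
  rcases isEmpty_or_nonempty X with hX | hX
  · rw [Measure.eq_zero_of_isEmpty μ, Measure.eq_zero_of_isEmpty ν]
  have hemb : MeasurableEmbedding (S.restrict F) :=
    hF.continuousOn.measurableEmbedding hS hinj
  obtain ⟨Ψ, hΨm, hΨ⟩ := hemb.exists_measurable_extend measurable_subtype_coe fun _ => hX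
  have hΨS : ∀ x ∈ S, Ψ (F x) = x := fun x hx => congr_fun hΨ ⟨x, hx⟩
  have himg : MeasurableSet (F '' S) := hS.image_of_continuousOn_injOn hF.continuousOn hinj
  have hνimg : ∀ᵐ y ∂(ν.map F), y ∈ F '' S :=
    (ae_map_iff hF.aemeasurable himg).2 (hν.mono fun x hx => mem_image_of_mem F hx)
  rw [← hmap] at hνimg
  have hμS : ∀ᵐ x ∂μ, x ∈ S := by
    filter_upwards [(ae_map_iff hF.aemeasurable himg).1 hνimg, hμ] with x hx hx'
    obtain ⟨y, hy, hyx⟩ := hx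
    rwa [hx' y hy hyx]
  have key : ∀ ρ : Measure X, (∀ᵐ x ∂ρ, x ∈ S) → ρ = (ρ.map F).map Ψ := fun ρ hρ => by
    rw [Measure.map_map hΨm hF.measurable]
    conv_lhs => rw [← Measure.map_id (μ := ρ)]
    exact Measure.map_congr (hρ.mono fun x hx => (hΨS x hx).symm)
  rw [key μ hμS, key ν hν, hmap]

/-! ### Traces separate simple classes with a common source -/

/-- Two classes with the same point `⟨range, _, _⟩` of the hyperspace `NonemptyCompacts ℂ` have the
same trace. [folklore] -/
theorem range_eq_of_rangeNC_eq {c c' : CurveClass ℂ}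
    (h : (⟨⟨c.range, c.isCompact_range⟩, c.range_nonempty⟩ : NonemptyCompacts ℂ) =
      ⟨⟨c'.range, c'.isCompact_range⟩, c'.range_nonempty⟩) : c.range = c'.range :=
  congrArg (fun K : NonemptyCompacts ℂ => (K : Set ℂ)) h

/-- **A simple class does not retrace**: every representative of a simple class is flat
(`Negative.isFlat_of_mk_mem_simple`), so `γ r = γ t` with `r ≤ u ≤ t` forces `γ u = γ r`.
[folklore] -/
theorem not_retrace_of_mem_simple {c : CurveClass ℂ}
    (hc : c ∈ (CurveClass.simple : Set (CurveClass ℂ))) :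
    ¬ ∃ γ : Curve ℂ, CurveClass.mk γ = c ∧
      ∃ r u t : unitInterval, r < u ∧ u < t ∧ γ r = γ t ∧ γ u ≠ γ r ∧
        γ '' Set.Icc u t ⊆ γ '' Set.Icc r u := by
  rintro ⟨γ, hγ, r, u, t, hru, hut, hrt, hur, -⟩
  rw [← hγ] at hc
  exact hur (Negative.isFlat_of_mk_mem_simple hc r u t hru.le hut.le hrt)

/-- **Under `MonotoneOfNoRetrace`, a non-retracing class is pinned by its trace and source among
the simple classes**: if `c` does not retrace and a simple class `y` has the same trace and the same
source, then `c = y` (apply the hypothesis to an injective representative of `y`). [folklore] -/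
theorem eq_of_mem_simple_of_range_eq
    (hMono : ∀ (c : CurveClass ℂ) (α : Curve ℂ), Function.Injective α → α.range = c.range →
      α.source = c.source →
      (¬ ∃ γ : Curve ℂ, CurveClass.mk γ = c ∧
        ∃ r u t : unitInterval, r < u ∧ u < t ∧ γ r = γ t ∧ γ u ≠ γ r ∧
          γ '' Set.Icc u t ⊆ γ '' Set.Icc r u) →
      c = CurveClass.mk α)
    {c y : CurveClass ℂ} (hy : y ∈ (CurveClass.simple : Set (CurveClass ℂ)))
    (hrange : y.range = c.range) (hsource : y.source = c.source)
    (hc : ¬ ∃ γ : Curve ℂ, CurveClass.mk γ = c ∧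
      ∃ r u t : unitInterval, r < u ∧ u < t ∧ γ r = γ t ∧ γ u ≠ γ r ∧
        γ '' Set.Icc u t ⊆ γ '' Set.Icc r u) : c = y := by
  obtain ⟨α, hα, rfl⟩ := hy
  exact hMono c α hα hrange hsource hc

/-- **The trace map is injective on the simple classes with a fixed source** (under
`MonotoneOfNoRetrace`). [folklore] -/
theorem injOn_rangeNC_simple
    (hMono : ∀ (c : CurveClass ℂ) (α : Curve ℂ), Function.Injective α → α.range = c.range →
      α.source = c.source →
      (¬ ∃ γ : Curve ℂ, CurveClass.mk γ = c ∧
        ∃ r u t : unitInterval, r < u ∧ u < t ∧ γ r = γ t ∧ γ u ≠ γ r ∧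
          γ '' Set.Icc u t ⊆ γ '' Set.Icc r u) →
      c = CurveClass.mk α) (p : ℂ) :
    InjOn (fun c : CurveClass ℂ =>
        (⟨⟨c.range, c.isCompact_range⟩, c.range_nonempty⟩ : NonemptyCompacts ℂ))
      ((CurveClass.simple : Set (CurveClass ℂ)) ∩ {c | c.source = p}) := by
  rintro c ⟨hc, hcs⟩ c' ⟨hc', hc's⟩ h
  exact (eq_of_mem_simple_of_range_eq hMono hc (range_eq_of_rangeNC_eq h) (hcs.trans hc's.symm)
    (not_retrace_of_mem_simple hc')).symm

/-- The set of simple classes with a fixed source is Borel (`CurveClass.measurableSet_simple'`,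
continuity of `source`). [folklore] -/
theorem measurableSet_simple_inter_source (p : ℂ) :
    MeasurableSet ((CurveClass.simple : Set (CurveClass ℂ)) ∩ {c | c.source = p}) :=
  CurveClass.measurableSet_simple'.inter
    ((isClosed_eq CurveClass.continuous_source continuous_const).measurableSet)

/-! ### The registered stub -/

/-- **Stub C `stub_curveLawOfRangeLaw`** of the line `hull-first-retrace`:
`HexRangeLimit → HexNoRetraceLimits → MonotoneOfNoRetrace → CurveIdentification`.  For a
probability subsequential limit `μ` of the curve laws and the SLE(8/3) curve `Γ` of the trace
limit: the trace push-forwards of `μ` and of `ν := P.map Γ` agree (uniqueness of weak limits on the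
metric hyperspace), `ν` is carried by the simple classes from `a`, `μ`-a.e. class starts at `a` and
does not retrace, and the trace map is injective on simple classes from `a` with every
non-retracing class of the same trace and source equal to the simple one (`MonotoneOfNoRetrace`);
Lusin–Souslin then identifies `μ = ν` (`measure_eq_of_map_eq_of_injOn`). [folklore] -/
theorem stub_curveLawOfRangeLaw :
    (∀ (D : DobrushinDomain) (a b : ℝ → HexVertex), IsEmbEndpointApprox hexGraph hexCenter D a b →
      ∃ Γ : (ℝ≥0 → ℝ) → CurveClass ℂ, IsSLECurve ((8 : ℝ≥0) / 3) D Γ ∧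
        TendstoLaw
          (fun δ (γ : HexDomainSAW D.carrier δ (a δ) (b δ)) =>
            (⟨⟨γ.curve.range, γ.curve.isCompact_range⟩, γ.curve.range_nonempty⟩ :
              TopologicalSpace.NonemptyCompacts ℂ))
          (fun δ => hexSAWLaw D.carrier δ (a δ) (b δ))
          (fun ω => (⟨⟨(Γ ω).range, (Γ ω).isCompact_range⟩, (Γ ω).range_nonempty⟩ :
              TopologicalSpace.NonemptyCompacts ℂ))
          Literature.Probability.Process.preWienerMeasure) →
    (∀ (D : DobrushinDomain) (a b : ℝ → HexVertex), IsEmbEndpointApprox hexGraph hexCenter D a b →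
      ∀ (s : ℕ → ℝ) (ν : Measure (CurveClass ℂ)), Tendsto s atTop (𝓝[>] 0) → IsProbabilityMeasure ν →
        (∀ f : CurveClass ℂ →ᵇ ℝ,
          Tendsto (fun n => ∫ γ, f γ.curve ∂(hexSAWLaw D.carrier (s n) (a (s n)) (b (s n)))) atTop
            (𝓝 (∫ x, f x ∂ν))) →
        ∀ᵐ c ∂ν, ¬ ∃ γ : Curve ℂ, CurveClass.mk γ = c ∧
          ∃ r u t : unitInterval, r < u ∧ u < t ∧ γ r = γ t ∧ γ u ≠ γ r ∧
            γ '' Set.Icc u t ⊆ γ '' Set.Icc r u) →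
    (∀ (c : CurveClass ℂ) (α : Curve ℂ), Function.Injective α → α.range = c.range → α.source = c.source →
      (¬ ∃ γ : Curve ℂ, CurveClass.mk γ = c ∧
        ∃ r u t : unitInterval, r < u ∧ u < t ∧ γ r = γ t ∧ γ u ≠ γ r ∧
          γ '' Set.Icc u t ⊆ γ '' Set.Icc r u) →
      c = CurveClass.mk α) →
    ∀ (D : DobrushinDomain) (a b : ℝ → HexVertex), IsEmbEndpointApprox hexGraph hexCenter D a b →
      ∀ μ : Measure (CurveClass ℂ), IsProbabilityMeasure μ →
        IsSubseqLimitLaw (fun δ (γ : HexDomainSAW D.carrier δ (a δ) (b δ)) => γ.curve)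
          (fun δ => hexSAWLaw D.carrier δ (a δ) (b δ)) μ →
        IsSLELaw ((8 : ℝ≥0) / 3) D μ := by
  intro hRange hNoRetrace hMono D a b hab μ hμP hμ
  obtain ⟨Γ, hΓ, hlaw⟩ := hRange D a b hab
  refine ⟨Γ, hΓ, ?_⟩
  -- Borel structure on the hyperspace; the SLE law `ν`; the trace map `F`
  letI : MeasurableSpace (NonemptyCompacts ℂ) := borel _
  haveI : BorelSpace (NonemptyCompacts ℂ) := ⟨rfl⟩
  haveI : IsProbabilityMeasure Literature.Probability.Process.preWienerMeasure :=
    isProbabilityMeasure_preWienerMeasure'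
  set ν : Measure (CurveClass ℂ) := Literature.Probability.Process.preWienerMeasure.map Γ with hν
  haveI : IsProbabilityMeasure ν := Measure.isProbabilityMeasure_map hΓ.aemeasurable
  obtain ⟨s, hs, hlim⟩ := hμ
  set F : CurveClass ℂ → NonemptyCompacts ℂ := fun c =>
    ⟨⟨c.range, c.isCompact_range⟩, c.range_nonempty⟩ with hF
  have hFc : Continuous F := continuous_rangeNC
  -- (i) the trace push-forwards agree
  have hmap : μ.map F = ν.map F := by
    apply ext_of_forall_integral_eq_of_IsFiniteMeasure
    intro g
    have h3 : ∫ x, g (F x) ∂ν = ∫ ω, g (F (Γ ω)) ∂Literature.Probability.Process.preWienerMeasure :=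
      integral_map hΓ.aemeasurable (g.continuous.comp hFc).aestronglyMeasurable
    rw [integral_map hFc.measurable.aemeasurable g.continuous.aestronglyMeasurable,
      integral_map hFc.measurable.aemeasurable g.continuous.aestronglyMeasurable, h3]
    have h1 := hlim (g.compContinuous ⟨F, hFc⟩)
    have h2 : Tendsto (fun n => ∫ γ, (g.compContinuous ⟨F, hFc⟩) γ.curve
        ∂(hexSAWLaw D.carrier (s n) (a (s n)) (b (s n)))) atTop
        (𝓝 (∫ ω, g (F (Γ ω)) ∂Literature.Probability.Process.preWienerMeasure)) :=
      (hlaw g).comp hs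
    exact tendsto_nhds_unique h1 h2
  -- (ii) the SLE law is carried by the simple classes from `a`
  have hνS : ∀ᵐ c ∂ν, c ∈ (CurveClass.simple : Set (CurveClass ℂ)) ∩ {c | c.source = D.pt 0} :=
    (Negative.ae_mem_chordalCarrier_of_isSLELaw_eightThirds hΓ.isSLELaw_map).mono
      fun c hc => hc.1.1
  -- (iii) `μ`-a.e. class starts at `a` and does not retrace, hence is pinned by its trace
  have hsrc : ∀ᵐ c ∂μ, c.source = D.pt 0 := FloorRatio.ae_source_eq ⟨s, hs, hlim⟩ hab.tendsto_fst
  have hμ' : ∀ᵐ c ∂μ, ∀ y ∈ (CurveClass.simple : Set (CurveClass ℂ)) ∩ {c | c.source = D.pt 0},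
      F y = F c → c = y := by
    filter_upwards [hsrc, hNoRetrace D a b hab s μ hs hμP hlim] with c hc hcr y hy hyc
    exact eq_of_mem_simple_of_range_eq hMono hy.1 (range_eq_of_rangeNC_eq hyc)
      (hy.2.trans hc.symm) hcr
  -- (iv) Lusin–Souslin
  exact measure_eq_of_map_eq_of_injOn hFc (measurableSet_simple_inter_source _)
    (injOn_rangeNC_simple hMono _) hmap hνS hμ'

end Summit.CriticalPhenomena.SAWScalingLimit.Theorems.ObservableToSLER.HullFirst

end
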